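import Literature.AlgebraicGeometry.Motives.CurvePointDivisor
import Literature.AlgebraicGeometry.Motives.AbelianVarietyLie
import Literature.NumberTheory.DiophantineGeometry.FunctionFieldResidues
import Mathlib.AlgebraicGeometry.AlgClosed.Basic
import HarnessLib

/-!
# Reduction of field-valued points of a proper scheme at a place of a function field

For a proper `Ω`-scheme `Y`, a field `M ⊇ Ω` and a place `w` of `M/Ω` (a discrete valuation ring
`𝒪_w ⊆ M` containing `Ω`), every `M`-valued point `x : Spec M → Y` over `Ω` extends uniquely to an
`𝒪_w`-valued point (valuative criterion of properness, Hartshorne II.4 Thm. 4.7; Mathlib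
`UniversallyClosed.eq_valuativeCriterion`, `IsSeparated.valuativeCriterion`); at a *rational*
place (`κ(w) = Ω`) its value at the closed point is an `Ω`-point `red x ∈ Y(Ω)`, the **reduction
(specialisation) of `x` at `w`**. This is the specialisation step in Lang's proof of Abel's theorem
(*Abelian Varieties* II §2, proof of Thm. 10: "`x'_i → x_i` be a specialization … `T(u) → T(z)`"):

* `PlaceReduction.liftOver`, `genOver_liftOver`, `eq_liftOver` — the `𝒪_w`-point and its uniqueness;
* `PlaceReduction.resAlgHom` — the residue map `𝒪_w → Ω` at a rational place; `closedOver`;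
* `PlaceReduction.red`, `red_const` — reduction, and reduction of a constant point is itself;
* `PlaceReduction.redHom` — **on an abelian variety, reduction is a homomorphism `A(M) → A(Ω)`**
  (uniqueness of lifts);
* `PlaceReduction.genericPt`, `embPt τ` — the `M`-point `Spec M → Spec K(C) → C` of a smooth
  complete curve `C` attached to an `Ω`-embedding `τ : K(C) → M`; `ptOfPlace v ∈ C(Ω)` — the
  `Ω`-point at the centre of a place `v` of `K(C)` (`Ω` algebraically closed);
* **`PlaceReduction.red_embPt`** — the reduction at `w` of `embPt τ` is `ptOfPlace (τ^* w)`, where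
  `τ^* w = τ⁻¹(𝒪_w)` (the centre of `w ∘ τ` on `C`, Hartshorne II.6 Lemma 6.5 / Cor. 6.6).

Everything is proved; `def`s are constructions with bodies; no named facts (D-0026).

## References

* R. Hartshorne, *Algebraic Geometry*, II.4 Thm. 4.7, II.6 Lemma 6.5, Cor. 6.6. [Hartshorne1977]
* S. Lang, *Abelian Varieties* (1959/1983), II §2, proof of Thm. 10. [Lang1983AbelianVarieties]
* H. Stichtenoth, *Algebraic Function Fields and Codes*, 2nd ed., Def. 1.1.14. [Stichtenoth2009]
-/

noncomputable section

open CategoryTheory CategoryTheory.Limits AlgebraicGeometry IsLocalRing MonoidalCategory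
  CartesianMonoidalCategory

universe u

namespace Literature.AlgebraicGeometry.Motives

open scoped MonObj

open Literature.NumberTheory.DiophantineGeometry
  Literature.NumberTheory.DiophantineGeometry.AlgFunctionField

namespace PlaceReduction

variable {Ω : Type u} [Field Ω]

/-! ### Lifting field-valued points of a proper scheme over the valuation ring of a place -/

section Lift

variable (Y : SchemeOver Ω) {M : Type u} [Field M] [Algebra Ω M] (w : PlaceOver Ω M)

/-- The valuative square of an `M`-point `x` at a place `w` of `M/Ω`:
`Spec M → Y` over `Spec 𝒪_w → Spec Ω`. [folklore] -/
def sq (x : AlgPoints Y M) : ValuativeCommSq Y.hom where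
  R := w.toValuationSubring
  K := M
  i₁ := x.left
  i₂ := Spec.map (CommRingCat.ofHom (algebraMap Ω w.toValuationSubring))
  commSq := ⟨by
    refine (Over.w x).trans ?_
    change Spec.map (CommRingCat.ofHom (algebraMap Ω M)) = Spec.map _ ≫ Spec.map _
    rw [← Spec.map_comp, ← CommRingCat.ofHom_comp, ← IsScalarTower.algebraMap_eq]⟩

/-- `Spec 𝒪_w` as an `Ω`-scheme. [folklore] -/
abbrev specO : SchemeOver Ω := specOver Ω w.toValuationSubring

/-- The generic point `Spec M → Spec 𝒪_w` over `Ω`. [folklore] -/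
abbrev genOver : specOver Ω M ⟶ specO w :=
  AlgPoints.specOverMapOfAlgHom (IsScalarTower.toAlgHom Ω w.toValuationSubring M)

variable [IsProper Y.hom]

/-- A chosen lift `Spec 𝒪_w → Y` of an `M`-point (existence part of the valuative criterion of
properness, Mathlib `UniversallyClosed.eq_valuativeCriterion`). [folklore] -/
def liftStruct (x : AlgPoints Y M) : (sq Y w x).commSq.LiftStruct := by
  have hE : ValuativeCriterion.Existence Y.hom := by
    have h : (ValuativeCriterion.Existence ⊓ @QuasiCompact) Y.hom := by
      rw [← UniversallyClosed.eq_valuativeCriterion]; infer_instance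
    exact h.1
  exact (hE (sq Y w x)).exists_lift.some

/-- **The `𝒪_w`-point of the proper `Y` extending an `M`-point** (valuative criterion of
properness). [folklore] -/
def liftOver (x : AlgPoints Y M) : specO w ⟶ Y :=
  Over.homMk (liftStruct Y w x).l (liftStruct Y w x).fac_right

/-- The underlying morphism of the lift. [folklore] -/
theorem liftOver_left (x : AlgPoints Y M) : (liftOver Y w x).left = (liftStruct Y w x).l := rfl

/-- The lift restricts to `x` at the generic point. [folklore] -/
@[simp]
theorem genOver_liftOver (x : AlgPoints Y M) : genOver w ≫ liftOver Y w x = x := by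
  apply Over.OverMorphism.ext
  rw [Over.comp_left, AlgPoints.specOverMapOfAlgHom_left, liftOver_left]
  exact (liftStruct Y w x).fac_left

/-- **Uniqueness of the lift** (valuative criterion of separatedness): an `𝒪_w`-point restricting
to `x` at the generic point is the chosen lift. [folklore] -/
theorem eq_liftOver {x : AlgPoints Y M} {l : specO w ⟶ Y} (h : genOver w ≫ l = x) :
    l = liftOver Y w x := by
  haveI : Subsingleton (sq Y w x).commSq.LiftStruct := IsSeparated.valuativeCriterion Y.hom _
  let L : (sq Y w x).commSq.LiftStruct :=
    { l := l.left
      fac_left := congrArg (fun g : specOver Ω M ⟶ Y => g.left) h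
      fac_right := Over.w l }
  apply Over.OverMorphism.ext
  exact congrArg (fun S : (sq Y w x).commSq.LiftStruct => S.l) (Subsingleton.elim L (liftStruct Y w x))

/-- The lift of a constant point `Spec M → Spec Ω → Y` is the constant `𝒪_w`-point. [folklore] -/
theorem liftOver_const (a : AlgPoints Y Ω) :
    liftOver Y w (AlgPoints.specOverMapOfAlgHom (Algebra.ofId Ω M) ≫ a) =
      AlgPoints.specOverMapOfAlgHom (Algebra.ofId Ω w.toValuationSubring) ≫ a := by
  symm
  apply eq_liftOver
  rw [← Category.assoc, AbelianVariety.specOverMapOfAlgHom_comp,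
    Subsingleton.elim ((IsScalarTower.toAlgHom Ω w.toValuationSubring M).comp
      (Algebra.ofId Ω w.toValuationSubring)) (Algebra.ofId Ω M)]

end Lift

/-! ### Reduction at a rational place -/

section Rational

variable {M : Type u} [Field M] [Algebra Ω M] [IsAlgFunctionField Ω M] {w : PlaceOver Ω M}

/-- At a rational place, `Ω ≃ κ(w)`. [cite: Stichtenoth2009, Def. 1.1.14] -/
def resEquiv (hw : w.IsRational) : Ω ≃+* w.residueField :=
  RingEquiv.ofBijective (algebraMap Ω w.residueField)
    ⟨(algebraMap Ω w.residueField).injective, hw.algebraMap_residueField_surjective⟩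

/-- Unfolding of `resEquiv`. [folklore] -/
@[simp]
theorem resEquiv_apply (hw : w.IsRational) (c : Ω) : resEquiv hw c = algebraMap Ω w.residueField c :=
  rfl

/-- **The residue map `𝒪_w → Ω` at a rational place**, as an `Ω`-algebra homomorphism.
[cite: Stichtenoth2009, Def. 1.1.14] -/
def resAlgHom (hw : w.IsRational) : w.toValuationSubring →ₐ[Ω] Ω :=
  { (resEquiv hw).symm.toRingHom.comp (IsLocalRing.residue w.toValuationSubring) with
    commutes' := fun c => by
      change (resEquiv hw).symm (IsLocalRing.residue _ (algebraMap Ω w.toValuationSubring c)) = c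
      rw [← PlaceOver.algebraMap_residueField_apply, ← resEquiv_apply hw, RingEquiv.symm_apply_apply] }

/-- Unfolding of `resAlgHom`. [folklore] -/
theorem resAlgHom_apply (hw : w.IsRational) (a : w.toValuationSubring) :
    resAlgHom hw a = (resEquiv hw).symm (IsLocalRing.residue _ a) := rfl

/-- The residue map is a local homomorphism. [folklore] -/
instance isLocalHom_resAlgHom (hw : w.IsRational) : IsLocalHom (resAlgHom hw).toRingHom := by
  refine ⟨fun a ha ↦ ?_⟩
  by_contra hna
  have hmem : a ∈ IsLocalRing.maximalIdeal w.toValuationSubring := hna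
  have h0 : resAlgHom hw a = 0 := by
    rw [resAlgHom_apply, (IsLocalRing.residue_eq_zero_iff _).2 hmem, map_zero]
  exact ha.ne_zero h0

/-- The kernel of the residue map is the maximal ideal: `Spec` of it hits the closed point.
[folklore] -/
theorem specMap_resAlgHom_closedPoint (hw : w.IsRational) :
    Spec.map (CommRingCat.ofHom (resAlgHom hw).toRingHom) (closedPoint Ω) =
      closedPoint w.toValuationSubring := by
  rw [Spec.map_apply]
  exact IsLocalRing.comap_closedPoint (resAlgHom hw).toRingHom

/-- The `Ω`-point of `Spec 𝒪_w` at the closed point. [folklore] -/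
abbrev closedOver (hw : w.IsRational) : specOver Ω Ω ⟶ specO w :=
  AlgPoints.specOverMapOfAlgHom (resAlgHom hw)

variable (Y : SchemeOver Ω) [IsProper Y.hom]

/-- **The reduction `Y(M) → Y(Ω)` at a rational place `w` of `M/Ω`** of the proper `Ω`-scheme
`Y`: extend the point over `𝒪_w` and restrict to the closed point. [folklore] -/
def red (hw : w.IsRational) (x : AlgPoints Y M) : AlgPoints Y Ω :=
  closedOver hw ≫ liftOver Y w x

/-- Unfolding of `red`. [folklore] -/
theorem red_def (hw : w.IsRational) (x : AlgPoints Y M) :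
    red Y hw x = closedOver hw ≫ liftOver Y w x := rfl

/-- Reduction of a constant point is the point itself. [folklore] -/
theorem red_const (hw : w.IsRational) (a : AlgPoints Y Ω) :
    red Y hw (AlgPoints.specOverMapOfAlgHom (Algebra.ofId Ω M) ≫ a) = a := by
  rw [red_def, liftOver_const, ← Category.assoc, AbelianVariety.specOverMapOfAlgHom_comp]
  have : (resAlgHom hw).comp (Algebra.ofId Ω ↥w.toValuationSubring) = AlgHom.id Ω Ω :=
    Subsingleton.elim _ _
  rw [this, AbelianVariety.specOverMapOfAlgHom_id, Category.id_comp]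

end Rational

/-! ### Reduction on an abelian variety is a homomorphism -/

section Abelian

variable {M : Type u} [Field M] [Algebra Ω M] [IsAlgFunctionField Ω M] {w : PlaceOver Ω M}
  (A : AbelianVariety Ω)

omit [IsAlgFunctionField Ω M] in
/-- The lift of a product is the product of the lifts. [folklore] -/
theorem liftOver_mul (x y : AlgPoints A.X M) :
    liftOver A.X w (x * y) = liftOver A.X w x * liftOver A.X w y := by
  symm
  apply eq_liftOver
  rw [MonObj.comp_mul, genOver_liftOver, genOver_liftOver]

/-- **Reduction at a rational place is a group homomorphism `A(M) → A(Ω)`.** [folklore] -/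
def redHom (hw : w.IsRational) : AlgPoints A.X M →* AlgPoints A.X Ω where
  toFun := red A.X hw
  map_one' := by
    rw [red_def]
    have h1 : liftOver A.X w (1 : AlgPoints A.X M) = 1 := by
      symm; apply eq_liftOver; rw [MonObj.comp_one]
    rw [h1, MonObj.comp_one]
  map_mul' x y := by
    simp only [red_def]
    rw [liftOver_mul, MonObj.comp_mul]

/-- Unfolding of `redHom`. [folklore] -/
@[simp]
theorem redHom_apply (hw : w.IsRational) (x : AlgPoints A.X M) : redHom A hw x = red A.X hw x := rfl

end Abelian

/-! ### Reduction of the generic point of a curve twisted by an embedding of its function field -/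

section Curve

variable [IsAlgClosed Ω] {C : SchemeOver Ω} [IsIntegral C.left] [SmoothOfRelativeDimension 1 C.hom]
  [IsProper C.hom]

/-- The generic point of `C` as a `K(C)`-valued point over `Ω`. [folklore] -/
def genericPt (C : SchemeOver Ω) [IsIntegral C.left] : AlgPoints C C.left.functionField :=
  AlgPoints.mk (C.left.fromSpecStalk (genericPoint C.left)) (CurvePlaces.fromSpecStalk_comp_hom C _)

omit [IsAlgClosed Ω] [SmoothOfRelativeDimension 1 C.hom] [IsProper C.hom] in
/-- Unfolding of `genericPt`. [folklore] -/
@[simp]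
theorem genericPt_left : (genericPt C).left = C.left.fromSpecStalk (genericPoint C.left) := rfl

/-- The `M`-valued point `Spec M → Spec K(C) → C` attached to an `Ω`-embedding `τ : K(C) → M`.
[folklore] -/
def embPt {M : Type u} [Field M] [Algebra Ω M] (τ : C.left.functionField →ₐ[Ω] M) :
    AlgPoints C M :=
  AlgPoints.specOverMapOfAlgHom τ ≫ genericPt C

/-- **The `Ω`-point of `C` at a place `v` of `K(C)/Ω`** (the centre of `v`, a closed point, hence
an `Ω`-point since `Ω` is algebraically closed; Hartshorne II.6 Cor. 6.6 with Mathlib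
`pointOfClosedPoint`). [cite: Hartshorne1977, II.6 Cor. 6.6] -/
def ptOfPlace (v : PlaceOver Ω C.left.functionField) : AlgPoints C Ω :=
  AlgPoints.mk (pointOfClosedPoint C.hom (CurvePlaces.pointOfPlace (C := C) v)
      (CurvePlaces.isClosed_singleton C (CurvePlaces.pointOfPlace_ne_genericPoint v))) (by
    rw [pointOfClosedPoint_comp, Algebra.algebraMap_self, CommRingCat.ofHom_id, Spec.map_id])

/-- The underlying point of `ptOfPlace v` is the centre of `v`. [folklore] -/
theorem ptOfPlace_left_closedPoint (v : PlaceOver Ω C.left.functionField) :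
    (ptOfPlace v).left (closedPoint Ω) = CurvePlaces.pointOfPlace (C := C) v :=
  pointOfClosedPoint_apply _ _ _ _

omit [IsAlgClosed Ω] [IsIntegral C.left] [SmoothOfRelativeDimension 1 C.hom] [IsProper C.hom] in
/-- An `Ω`-point of `C` composed with the structure map is the identity of `Spec Ω`. [folklore] -/
theorem left_comp_hom_eq_id (P : AlgPoints C Ω) : P.left ≫ C.hom = 𝟙 _ := by
  rw [Over.w P]
  change Spec.map (CommRingCat.ofHom (algebraMap Ω Ω)) = 𝟙 _
  rw [Algebra.algebraMap_self, CommRingCat.ofHom_id, Spec.map_id]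

omit [IsIntegral C.left] [SmoothOfRelativeDimension 1 C.hom] in
/-- Two `Ω`-points of `C` with the same underlying point are equal. [folklore] -/
theorem algPoints_ext {P Q : AlgPoints C Ω} (h : P.left (closedPoint Ω) = Q.left (closedPoint Ω)) :
    P = Q :=
  Over.OverMorphism.ext (ext_of_apply_closedPoint_eq C.hom (left_comp_hom_eq_id P)
    (left_comp_hom_eq_id Q) h)

variable {M : Type u} [Field M] [Algebra Ω M] [IsAlgFunctionField Ω M] {w : PlaceOver Ω M}

open CurvePlaces RatFn in
/-- **Reduction of the twisted generic point**: for an `Ω`-embedding `τ : K(C) → M` and a rational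
place `w` of `M`, the reduction at `w` of the `M`-point `Spec M → Spec K(C) → C` is the `Ω`-point of
`C` at the place `τ^* w = τ⁻¹(𝒪_w)` of `K(C)` (the centre of the valuation `w ∘ τ` on the complete
curve `C`, Hartshorne II.6 Lemma 6.5 / valuative criterion II.4.7). [cite: Hartshorne1977, II.6 Lemma 6.5 and Cor. 6.6] -/
theorem red_embPt (hw : w.IsRational) (τ : C.left.functionField →ₐ[Ω] M)
    (v : PlaceOver Ω C.left.functionField)
    (hv : ∀ g, g ∈ v.toValuationSubring ↔ τ g ∈ w.toValuationSubring) :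
    red C hw (embPt τ) = ptOfPlace v := by
  -- the lift `l : Spec 𝒪_w → C` and its closed point `x₀`
  set l : Spec (.of w.toValuationSubring) ⟶ C.left := (liftOver C w (embPt τ)).left with hl
  have hl₁ : Spec.map (CommRingCat.ofHom (algebraMap w.toValuationSubring M)) ≫ l =
      Spec.map (CommRingCat.ofHom τ.toRingHom) ≫ C.left.fromSpecStalk (genericPoint C.left) :=
    (liftStruct C w (embPt τ)).fac_left
  set x₀ : C.left := l (closedPoint w.toValuationSubring) with hx₀
  let φ := Scheme.stalkClosedPointTo l
  have hφl : Spec.map φ ≫ C.left.fromSpecStalk x₀ = l := Scheme.Spec_stalkClosedPointTo_fromSpecStalk l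
  -- `𝒪_{C,x₀} → 𝒪_w → M` is `τ ∘ (𝒪_{C,x₀} ⊆ K(C))`
  have hcomp : φ ≫ CommRingCat.ofHom (algebraMap w.toValuationSubring M) =
      CommRingCat.ofHom (τ.toRingHom.comp (toFunctionField x₀)) := by
    apply ringHom_ext_of_fromSpecStalk C
    rw [Spec.map_comp, Category.assoc, hφl, hl₁, CommRingCat.ofHom_comp, Spec.map_comp,
      Category.assoc]
    change _ = Spec.map _ ≫ Spec.map (C.left.presheaf.stalkSpecializes (genericPoint_specializes x₀)) ≫ _
    rw [Scheme.SpecMap_stalkSpecializes_fromSpecStalk]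
  have hφ : ∀ a, ((φ a : w.toValuationSubring) : M) = τ (toFunctionField x₀ a) := fun a ↦
    congrArg (fun g : C.left.presheaf.stalk x₀ ⟶ CommRingCat.of M ↦ g a) hcomp
  -- every function regular at `x₀` maps into `𝒪_w` under `τ`
  have hsub : ∀ g, IsRegularAt x₀ g → τ g ∈ w.toValuationSubring := by
    rintro g ⟨a, rfl⟩
    rw [← hφ a]; exact Subtype.mem _
  -- `x₀` is not the generic point
  have hx₀ne : x₀ ≠ genericPoint C.left := by
    intro hxe
    apply v.ne_top
    refine top_unique fun g _ ↦ (hv g).2 (hsub g ?_)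
    rw [hxe]
    exact isRegularAt_genericPoint g
  -- the place of `x₀` is `τ^* w`
  have hplace : place C x₀ hx₀ne = v := by
    haveI := isDiscreteValuationRing_stalk C hx₀ne
    refine PlaceOver.ext (le_antisymm (fun g hg ↦ (hv g).2 (hsub g ((mem_place_iff hx₀ne).1 hg)))
      fun g hg ↦ ?_)
    rw [mem_place_iff]
    by_contra hng
    have hg0 : g ≠ 0 := by
      rintro rfl; exact hng ⟨0, map_zero _⟩
    -- `g⁻¹` is regular at `x₀` and lies in the maximal ideal
    have hinv : IsRegularAt x₀ g⁻¹ := by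
      have hmem : g⁻¹ ∈ (place C x₀ hx₀ne).toValuationSubring :=
        ((place C x₀ hx₀ne).toValuationSubring.mem_or_inv_mem g).resolve_left
          (fun h ↦ hng ((mem_place_iff hx₀ne).1 h))
      exact (mem_place_iff hx₀ne).1 hmem
    obtain ⟨b, hb⟩ := hinv
    have hbu : ¬ IsUnit b := by
      intro hbu
      apply hng
      refine ⟨(hbu.unit⁻¹ : (C.left.presheaf.stalk x₀)ˣ), ?_⟩
      have h1 : toFunctionField x₀ ((hbu.unit⁻¹ : (C.left.presheaf.stalk x₀)ˣ) : _) *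
          toFunctionField x₀ b = 1 := by
        rw [← map_mul, hbu.val_inv_mul, map_one]
      rw [hb] at h1
      exact (eq_inv_of_mul_eq_one_left h1).trans (inv_inv g)
    have hφb : ¬ IsUnit (φ b) := fun h ↦ hbu (isUnit_of_map_unit φ.hom b h)
    have hmax : (φ b : w.toValuationSubring) ∈ IsLocalRing.maximalIdeal _ := hφb
    have hval : ((φ b : w.toValuationSubring) : M) = (τ g)⁻¹ := by rw [hφ b, hb, map_inv₀]
    -- `τ g ∈ 𝒪_w` and `(τ g)⁻¹ ∈ 𝔪_w`: contradiction
    have htg : τ g ≠ 0 := (map_ne_zero τ).2 hg0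
    have hlt := (w.toValuationSubring.valuation_lt_one_iff _).1 hmax
    rw [hval, map_inv₀] at hlt
    have hle := (w.toValuationSubring.valuation_le_one_iff _).2 ((hv g).1 hg)
    have hone : w.toValuationSubring.valuation (τ g) ≠ 0 := by
      rwa [Ne, Valuation.zero_iff]
    exact absurd (inv_lt_one₀ (zero_lt_iff.2 hone) |>.1 hlt) (not_lt.2 hle)
  -- conclude by comparing the underlying closed points
  have hx₀v : pointOfPlace (C := C) v = x₀ := by
    rw [← hplace]; exact pointOfPlace_place hx₀ne
  apply algPoints_ext
  rw [ptOfPlace_left_closedPoint, hx₀v]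
  show (Spec.map (CommRingCat.ofHom (resAlgHom hw).toRingHom) ≫ l) (closedPoint Ω) = x₀
  rw [Scheme.Hom.comp_apply, specMap_resAlgHom_closedPoint]

end Curve

end PlaceReduction

end Literature.AlgebraicGeometry.Motives
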